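import Summits.HodgeConjecture.HodgeConjecture.Theorems.NikulinTwinTransportLefschetzOneOneK3DDbar
import Literature.AlgebraicGeometry.HodgeTheory.LefschetzOneOneChowProofs

/-!
# Route NikulinTwinTransport — `LefschetzOneOneK3`, `∂∂̄`–exponential line: the umbrella fact and the global-sections form

Two corollaries of `integral_vanishing_of_cechRationalBridge_at` /
`lefschetzOneOneK3_of_cechRationalBridge_of_isTrivialOn` (`…K3DDbar.lean`):

* `lefschetzOneOne_rational_of_cechRationalBridge_of_isTrivialOn` — the NAMED FACT
  `Literature.AlgebraicGeometry.HodgeTheory.lefschetzOneOne_rational` itself (every dimension) from the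
  Čech-rational bridge and the Kodaira–Serre triviality on Hodge models of smooth projective varieties,
  through the tree's `lefschetzOneOne_rational_of_integral_vanishing`;
* `lefschetzOneOneK3_of_cechRationalBridge_of_globalSections` — the route item with the Kodaira–Serre
  input in the global-sections form `h₂` of `lefschetzOneOneK3_of_chernWeil_of_globalSections`.
-/

noncomputable section

open scoped Manifold ContDiff Topology
open Set Filter
open Literature.AlgebraicTopology.SingularHomology (singularCohomology)
open Literature.AlgebraicGeometry
open Literature.AlgebraicGeometry.HodgeTheory
open Literature.Geometry.Kaehler
open Literature.NumberTheory.Transcendental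

namespace Summit.HodgeConjecture.HodgeConjecture.Theorems

open Summit.HodgeConjecture.HodgeConjecture.Theses.NikulinTwinTransport

/-! ### The umbrella fact and the global-sections form -/

section General

/-- **The named fact `lefschetzOneOne_rational` (Voisin I, §11.3.2) from the Čech-rational bridge and
the Kodaira–Serre triviality on Hodge models of smooth projective varieties of every dimension** — the
general form of `lefschetzOneOneK3_of_cechRationalBridge_of_isTrivialOn`, through the tree's
`lefschetzOneOne_rational_of_integral_vanishing` (Chow, universal coefficients). The complex-analytic
heart (Thm. 11.30) is `integral_vanishing_of_cechRationalBridge_at`; (B) is de Rham's theorem in Weil's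
Čech form with its `ℚ`-structure for the model's natural comparison, (T) is the meromorphic-section
lemma of the proof of Cor. 11.34. [cite: VoisinHodgeI2002, Thm. 11.30, Cor. 11.34, §11.3.2] -/
theorem lefschetzOneOne_rational_of_cechRationalBridge_of_isTrivialOn
    (hB : ∀ ⦃n : ℕ⦄ ⦃X : Motives.SchemeOver ℂ⦄, Motives.IsSmoothProjective n X →
      ∀ (A : HodgeModel n X) (ι : Type) [Fintype ι] (𝒰 : ChartConvexCover A.model A.carrier ι),
        ∃ r : ℂ, r ≠ 0 ∧
          ∀ (α : MForm 𝓘(ℝ, A.model) A.carrier ℂ 2) (hs : IsSmoothForm α) (hc : IsClosedForm α)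
            (η : ι → MForm 𝓘(ℝ, A.model) A.carrier ℂ 1)
            (_ : ∀ i, ∀ x ∈ 𝒰.U i, (η i).SmoothAt x ∧ mextDeriv (η i) x = α x)
            (f : ι → ι → A.carrier → ℂ)
            (_ : ∀ i j, ∀ x ∈ 𝒰.U i ∩ 𝒰.U j,
              (MForm.ofFun 𝓘(ℝ, A.model) (f i j)).SmoothAt x ∧
                mextDeriv (MForm.ofFun 𝓘(ℝ, A.model) (f i j)) x = η i x - η j x),
            IsRationalClass (A.deRham A.carrier 2
              (complexDeRhamCohomology.mk A.model A.carrier 2 ⟨α, mem_cclosedSmoothForms hs hc⟩)) →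
            ∃ (b : ι → ι → ℂ) (q : ι → ι → ι → ℚ), ∀ i j k, ∀ x ∈ 𝒰.U i ∩ 𝒰.U j ∩ 𝒰.U k,
              r * (f i j x + f j k x - f i k x) + (b i j + b j k - b i k) = (q i j k : ℂ))
    (hT : ∀ ⦃n : ℕ⦄ ⦃X : Motives.SchemeOver ℂ⦄, Motives.IsSmoothProjective n X →
      ∀ (A : HodgeModel n X) (ι : Type) (L : HolomorphicLineBundle ι A.model A.carrier),
        ∃ T : Set A.carrier, IsAnalyticSet 𝓘(ℂ, A.model) T ∧ T ≠ Set.univ ∧ L.IsTrivialOn Tᶜ) :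
    lefschetzOneOne_rational := by
  refine lefschetzOneOne_rational_of_integral_vanishing fun n X hX A β hβi hβ11 ↦ ?_
  haveI : CompactSpace A.carrier := A.compactSpace_carrier hX
  obtain ⟨t, ⟨𝒰⟩⟩ := exists_chartConvexCover (E := A.model) (M := A.carrier)
  exact integral_vanishing_of_cechRationalBridge_at A 𝒰 (hB hX A _ 𝒰) (fun L ↦ hT hX A _ L) β hβi hβ11

/-- **`LefschetzOneOneK3` from the bridge and the Kodaira–Serre SECTIONS** (the hypothesis `h₂` of
`lefschetzOneOneK3_of_chernWeil_of_globalSections`: every cocycle line bundle `L` on a Hodge model of a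
surface of the item has some `L'` with non-zero global sections of `L ⊗ L'` and of `L'`), the sections
giving the triviality off `{σ₁ = 0} ∪ {σ₂ = 0}` (`isTrivialOn_compl_analyticSet_of_globalSections_at`).
[cite: VoisinHodgeI2002, Cor. 11.34 (proof)] -/
theorem lefschetzOneOneK3_of_cechRationalBridge_of_globalSections
    (hB : ∀ ⦃S : Motives.SchemeOver ℂ⦄,
      (Motives.IsSmoothProjective 2 S ∧ Subsingleton (Motives.structureSheafCohomology S.left 1) ∧
        ∃ (A : HodgeModel 2 S) (η : MForm 𝓘(ℝ, A.model) A.carrier ℂ 2),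
          Literature.Geometry.Kaehler.IsHolomorphicInCharts η ∧ ∀ x, η x ≠ 0) →
      ∀ (A : HodgeModel 2 S) (ι : Type) [Fintype ι] (𝒰 : ChartConvexCover A.model A.carrier ι),
        ∃ r : ℂ, r ≠ 0 ∧
          ∀ (α : MForm 𝓘(ℝ, A.model) A.carrier ℂ 2) (hs : IsSmoothForm α) (hc : IsClosedForm α)
            (η : ι → MForm 𝓘(ℝ, A.model) A.carrier ℂ 1)
            (_ : ∀ i, ∀ x ∈ 𝒰.U i, (η i).SmoothAt x ∧ mextDeriv (η i) x = α x)
            (f : ι → ι → A.carrier → ℂ)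
            (_ : ∀ i j, ∀ x ∈ 𝒰.U i ∩ 𝒰.U j,
              (MForm.ofFun 𝓘(ℝ, A.model) (f i j)).SmoothAt x ∧
                mextDeriv (MForm.ofFun 𝓘(ℝ, A.model) (f i j)) x = η i x - η j x),
            IsRationalClass (A.deRham A.carrier 2
              (complexDeRhamCohomology.mk A.model A.carrier 2 ⟨α, mem_cclosedSmoothForms hs hc⟩)) →
            ∃ (b : ι → ι → ℂ) (q : ι → ι → ι → ℚ), ∀ i j k, ∀ x ∈ 𝒰.U i ∩ 𝒰.U j ∩ 𝒰.U k,
              r * (f i j x + f j k x - f i k x) + (b i j + b j k - b i k) = (q i j k : ℂ))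
    (h₂ : ∀ ⦃S : Motives.SchemeOver ℂ⦄,
      (Motives.IsSmoothProjective 2 S ∧ Subsingleton (Motives.structureSheafCohomology S.left 1) ∧
        ∃ (A : HodgeModel 2 S) (η : MForm 𝓘(ℝ, A.model) A.carrier ℂ 2),
          Literature.Geometry.Kaehler.IsHolomorphicInCharts η ∧ ∀ x, η x ≠ 0) →
      ∀ (A : HodgeModel 2 S) (ι : Type) (L : HolomorphicLineBundle ι A.model A.carrier),
        ∃ (κ : Type) (L' : HolomorphicLineBundle κ A.model A.carrier)
          (σ₁ : (L.tensor L').GlobalSection) (σ₂ : L'.GlobalSection),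
          σ₁.zeroSet ≠ Set.univ ∧ σ₂.zeroSet ≠ Set.univ) :
    LefschetzOneOneK3 :=
  lefschetzOneOneK3_of_cechRationalBridge_of_isTrivialOn hB fun _S hS A ι L ↦
    isTrivialOn_compl_analyticSet_of_globalSections_at hS.1 A ι L (h₂ hS A ι L)

end General

end Summit.HodgeConjecture.HodgeConjecture.Theorems

end
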